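import Summits.QuantumFields.BalabanUV.Beta.GAN24.Push4LegTelescope
import Summits.QuantumFields.BalabanUV.Beta.GAN24.CoDressedColumnPairing

/-!
# `BalabanUV.Beta.GAN24.Push4GaugeSlotCells` — binder row G-an2-4 ∕ (CONV-C), CT-W (the row owner gan24-p1-g22's «CT-W DESIGN v0» §2 (R-CT) ∕ §3 CT-W2 «summation by parts:
# χ × fine divergence of the source leg», the GENERIC KERNEL HALF): A PURE-GAUGE LEG FAMILY `(μ, y) ↦ dz (λ μ y)` IN ANY ONE OF THE FOUR SLOTS OF THE FOUR-FAMILY PUSH `push₄W l r v w X`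
# READS, AFTER LATTICE SUMMATION BY PARTS, AS «THE GAUGE FUNCTION UNDIFFERENTIATED AGAINST THE BACKWARD DIVERGENCE OF ITS NEIGHBOUR IN THAT SLOT» — the two TABLE slots against
# the divergence of the bi-stencil table in its first ∕ second BOND slot, the two KERNEL slots against the divergence of the bi-vertex in its left ∕ right KERNEL index.

NOT IN PRINT; OUR BOOKKEEPING (G-an2-4 formalisation swarm, leaf prover `b2b-balaban-gan24-formalise-leaf-03`, gen 57; the row owner gan24-p1 g23's W8: «WANTED — file under your
name as CT-W2's LEG-LEVEL KERNEL HALF» (the mechanism of both candidate closures (R-DEV) ∕ (R-GRW) of RULING R-gan24p1-g23-2, «one leg at a time»); the TABLE-LEVEL half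
(`(𝔇 − 1) Y` as one-slot defects) is leaf-06's `TableDressingDefect`; the Ward ∕ EL letters that EVALUATE the four divergences are NOT touched here).
HONEST FRAMING (cell contract, verbatim): «discharging `BetaPertH` makes Bałaban's UV stability UNCONDITIONAL — a real constructive-QFT result; it is NOT the continuum limit and NOT the
Clay problem.»  HONEST DEPENDENCY (verbatim): «continuum YM on T⁴ ⇐ BetaPertH ∧ nine spine estimates (0/9 proved); BetaPertH ⇐ (D1) ∧ (D4) ∧ CAP+tail; G-an2-4 gates asym, D1 and
NE2/3/4.»

WHAT ([folklore] lattice summation by parts — leaf-02 g51's `CoDressedColumnPairing.sum_tsum_grad_mul_eq_neg_tsum_mul_div` — pointwise in the kernel indices, and the `push₃`∕`push₄W` entry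
formulas; 0 `def`, 0 cited facts, 0 `def … : Prop`, 0 sorry; `dz f κ u = f (u + e_κ) − f u`, backward divergence `Σ_κ (g κ u − g κ (u − e_κ))`):
* §1 THE THREE ELEMENTARY SLOTS.  **`vertexW_gauge`**: for gauge functions `λ μ y` bounded per coarse bond and a stencil family with summable slices,
  `vertexW (μ y ↦ dz (λ μ y)) S μ y x z a b = −Σ'_u λ μ y u · Σ_κ (S κ u − S κ (u − e_κ)) x z a b`; **`comp_Lk_gauge`**: for a kernel with summable left columns,
  `comp (Lk (α x′ ↦ dz (λ α x′))) V x′ z (inl α) b = −Σ'_x λ α x′ x · Σ_κ (V x z (inl κ) b − V (x − e_κ) z (inl κ) b)`; **`comp_Rk_gauge`**: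
  `comp W (Rk (β z′ ↦ dz (λ β z′))) x z′ a (inl β) = −Σ'_z λ β z′ z · Σ_κ (W x z a (inl κ) − W x (z − e_κ) a (inl κ))`.
* §2 THE FOUR SLOTS OF `push₄W` (leaf-03's `Push4LegTelescope.push₄W`; ff entries — the only ones the push has): **`push₄W_gauge_inner`** (inner table leg: the divergence of `X κ u` in its
  SECOND bond slot, read through `(l, r, v)` as a `push₃`), **`push₄W_gauge_outer`** (outer table leg: the divergence of the inner-vertex family in the FIRST bond slot), **`push₄W_gauge_left_ff`**
  ∕ **`push₄W_gauge_right_ff`** (kernel legs: the divergence of the bi-vertex `vertexW v (κ u ↦ vertexW w (X κ u) ν y′) μ y` in its left ∕ right kernel index), each under the natural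
  boundedness ∕ summability side conditions (bounded legs, `LocStencil₂ X C δ` with `0 < δ`, gauge functions bounded per coarse bond).
USE (CT-W2 ∕ CT-W3): with `Push4LegTelescopeComb.transport_lin4_coDress_sub_eq` every term of `[𝒯^E − 𝒯^B](m, k+1) X` ((R-DEV): `X = g′_i` the deviation tower's charge-free forcing) is a
`push₄W` with exactly one slot `= ε • dz λ_{m,k}` (CT-2's staircase) — these four identities turn it into «`λ_{m,k}` undifferentiated × a divergence of the neighbour in that slot»,
the object CT-W3's staircase pairing (leaf-01's `ContactGaugeStaircase` ∕ the owner's `StaircasePairing`) estimates.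
Asserts NO shape or rate of an2's ∕ Bałaban's tables; NO estimate; discharges NOTHING of «T2Shape» ∕ «T2Drift» ∕ (hW, hWall); 0 wall binders; NEVER «G-an2-4 closed» as (CONV-C); NOT D1, NOT
BetaPertH, NOT continuum, NOT Clay; not in print — our bookkeeping.
-/

noncomputable section

open Finset
open scoped BigOperators
open Literature.MathematicalPhysics.QuantumFieldTheory
open Literature.MathematicalPhysics.QuantumFieldTheory.Balaban1983to89
open Literature.MathematicalPhysics.QuantumFieldTheory.Balaban1983to89.Beta
open B12Sec2to5 (l1 l1_nonneg)
open ExpKernelCalculus (MKer Site comp Zl Zl_nonneg)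
open AffineAveraging (Form0 Form1 dz unitVec)
open OneStepResolventKernel (Fib LocStencil)
open BalabanCompositeJets (LocStencil₂ summable_slice_of_locStencil summable_slice_of_locStencil₂)
open KKTFluctuationEnergy (summable_mul_of_bdd summable_mul_of_bdd')
open Summit.QuantumFields.BalabanUV.Beta.GAN24.Push4 (vertexW vertexW_apply Lk Rk ffRead Lk_inl_inl Lk_inl_inr Lk_inr Rk_inl_inl Rk_inr_left Rk_inr_right
  ffRead_inl_inl)
open Summit.QuantumFields.BalabanUV.Beta.GAN24.Push4NestAux (abs_vertexW_slice_le summable_vertexW_slice decays_vertexW_of_locStencil abs_le_of_decays)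
open Summit.QuantumFields.BalabanUV.Beta.GAN24.Push4Iter (BiTab LegFam)
open Summit.QuantumFields.BalabanUV.Beta.GAN24.Push3 (push₃ push₃_inl_inl)
open Summit.QuantumFields.BalabanUV.Beta.GAN24.Push3LegTelescope (abs_vertexW_le)
open Summit.QuantumFields.BalabanUV.Beta.GAN24.Push4LegTelescope (push₄W push₄W_eq_push₃ locStencil_inner)
open Summit.QuantumFields.BalabanUV.Beta.GAN24.CoDressedColumnPairing (sum_tsum_grad_mul_eq_neg_tsum_mul_div)

namespace Summit.QuantumFields.BalabanUV.Beta.GAN24.Push4GaugeSlotCells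

variable {d : ℕ}

/-! ## §1 The three elementary slots: a gauge leg in the table vertex, in the left kernel leg, in the right kernel leg -/

section Elementary

/-- [folklore] **A PURE-GAUGE LEG IN THE TABLE VERTEX = THE GAUGE FUNCTION AGAINST THE BACKWARD DIVERGENCE OF THE STENCIL FAMILY IN ITS BOND SLOT** (summation by parts,
pointwise in the kernel indices): for gauge functions bounded per coarse bond and a stencil family with summable bond slices,
`vertexW (μ y ↦ dz (λ μ y)) S μ y x z a b = −Σ'_u λ μ y u · Σ_κ (S κ u x z a b − S κ (u − e_κ) x z a b)`. -/
theorem vertexW_gauge {lam : Fin (d + 1) → Site (d + 1) → Form0 (d + 1) ℝ} {B : Fin (d + 1) → Site (d + 1) → ℝ}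
    (hlam : ∀ μ y u, |lam μ y u| ≤ B μ y) {S : Fin (d + 1) → Site (d + 1) → MKer (d + 1) (Fib d)}
    (hS : ∀ κ x z a b, Summable fun u => S κ u x z a b) (μ : Fin (d + 1)) (y : Site (d + 1)) (x z : Site (d + 1)) (a b : Fib d) :
    vertexW (fun μ y => dz (lam μ y)) S μ y x z a b
      = -∑' u : Site (d + 1), lam μ y u * ∑ κ : Fin (d + 1), (S κ u x z a b - S κ (u - unitVec κ) x z a b) := by
  rw [vertexW_apply]
  exact sum_tsum_grad_mul_eq_neg_tsum_mul_div (g := fun κ u => S κ u x z a b) (hlam μ y) (fun κ => hS κ x z a b)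

/-- [folklore] **A PURE-GAUGE LEFT KERNEL LEG = THE GAUGE FUNCTION AGAINST THE BACKWARD DIVERGENCE OF THE KERNEL IN ITS LEFT INDEX** (field rows; the multiplier rows of `Lk` vanish):
for gauge functions bounded per coarse bond and a kernel whose left field columns are summable,
`comp (Lk (α x′ ↦ dz (λ α x′))) V x′ z (inl α) b = −Σ'_x λ α x′ x · Σ_κ (V x z (inl κ) b − V (x − e_κ) z (inl κ) b)`. -/
theorem comp_Lk_gauge {lam : Fin (d + 1) → Site (d + 1) → Form0 (d + 1) ℝ} {B : Fin (d + 1) → Site (d + 1) → ℝ}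
    (hlam : ∀ α x' x, |lam α x' x| ≤ B α x') {V : MKer (d + 1) (Fib d)} (hV : ∀ z b κ, Summable fun x => V x z (Sum.inl κ) b)
    (x' z : Site (d + 1)) (α : Fin (d + 1)) (b : Fib d) :
    comp (Lk (fun α x' => dz (lam α x'))) V x' z (Sum.inl α) b
      = -∑' x : Site (d + 1), lam α x' x * ∑ κ : Fin (d + 1), (V x z (Sum.inl κ) b - V (x - unitVec κ) z (Sum.inl κ) b) := by
  have e : ∀ x : Site (d + 1), ∑ f : Fib d, Lk (fun α x' => dz (lam α x')) x' x (Sum.inl α) f * V x z f b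
      = ∑ κ : Fin (d + 1), (lam α x' (x + unitVec κ) - lam α x' x) * V x z (Sum.inl κ) b := by
    intro x
    rw [Fintype.sum_sum_type]
    simp only [Lk_inl_inl, Lk_inl_inr, zero_mul, Finset.sum_const_zero, add_zero]
    rfl
  simp only [comp, e]
  have hs : ∀ κ : Fin (d + 1), Summable fun x : Site (d + 1) => (lam α x' (x + unitVec κ) - lam α x' x) * V x z (Sum.inl κ) b := by
    intro κ
    have hB : 0 ≤ B α x' := (abs_nonneg _).trans (hlam α x' 0)
    refine Summable.of_norm_bounded ((hV z b κ).abs.mul_left (B α x' + B α x')) fun x => ?_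
    rw [Real.norm_eq_abs, abs_mul]
    exact mul_le_mul_of_nonneg_right ((abs_sub _ _).trans (add_le_add (hlam α x' _) (hlam α x' _))) (abs_nonneg _)
  rw [Summable.tsum_finsetSum fun κ _ => hs κ]
  exact sum_tsum_grad_mul_eq_neg_tsum_mul_div (g := fun κ x => V x z (Sum.inl κ) b) (hlam α x') (fun κ => hV z b κ)

/-- [folklore] **A PURE-GAUGE RIGHT KERNEL LEG = THE GAUGE FUNCTION AGAINST THE BACKWARD DIVERGENCE OF THE KERNEL IN ITS RIGHT INDEX** (field columns; the multiplier columns of `Rk`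
vanish): for a kernel whose right field rows are summable,
`comp W (Rk (β z′ ↦ dz (λ β z′))) x z′ a (inl β) = −Σ'_z λ β z′ z · Σ_κ (W x z a (inl κ) − W x (z − e_κ) a (inl κ))`. -/
theorem comp_Rk_gauge {lam : Fin (d + 1) → Site (d + 1) → Form0 (d + 1) ℝ} {B : Fin (d + 1) → Site (d + 1) → ℝ}
    (hlam : ∀ β z' z, |lam β z' z| ≤ B β z') {W : MKer (d + 1) (Fib d)} (hW : ∀ x a κ, Summable fun z => W x z a (Sum.inl κ))
    (x z' : Site (d + 1)) (a : Fib d) (β : Fin (d + 1)) :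
    comp W (Rk (fun β z' => dz (lam β z'))) x z' a (Sum.inl β)
      = -∑' z : Site (d + 1), lam β z' z * ∑ κ : Fin (d + 1), (W x z a (Sum.inl κ) - W x (z - unitVec κ) a (Sum.inl κ)) := by
  have e : ∀ z : Site (d + 1), ∑ f : Fib d, W x z a f * Rk (fun β z' => dz (lam β z')) z z' f (Sum.inl β)
      = ∑ κ : Fin (d + 1), (lam β z' (z + unitVec κ) - lam β z' z) * W x z a (Sum.inl κ) := by
    intro z
    rw [Fintype.sum_sum_type]
    simp only [Rk_inl_inl, Rk_inr_left, mul_zero, Finset.sum_const_zero, add_zero]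
    exact Finset.sum_congr rfl fun κ _ => by rw [mul_comm]; rfl
  simp only [comp, e]
  have hs : ∀ κ : Fin (d + 1), Summable fun z : Site (d + 1) => (lam β z' (z + unitVec κ) - lam β z' z) * W x z a (Sum.inl κ) := by
    intro κ
    refine Summable.of_norm_bounded ((hW x a κ).abs.mul_left (B β z' + B β z')) fun z => ?_
    rw [Real.norm_eq_abs, abs_mul]
    exact mul_le_mul_of_nonneg_right ((abs_sub _ _).trans (add_le_add (hlam β z' _) (hlam β z' _))) (abs_nonneg _)
  rw [Summable.tsum_finsetSum fun κ _ => hs κ]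
  exact sum_tsum_grad_mul_eq_neg_tsum_mul_div (g := fun κ z => W x z a (Sum.inl κ)) (hlam β z') (fun κ => hW x a κ)

end Elementary

/-! ## §2 The four slots of the four-family push -/

section Push

variable {l r v w : LegFam d} {X : BiTab d} {lam : Fin (d + 1) → Site (d + 1) → Form0 (d + 1) ℝ} {B : Fin (d + 1) → Site (d + 1) → ℝ}
  {Cl Cv Cw C δ : ℝ}

/-- [folklore] **INNER TABLE SLOT**: a pure-gauge INNER table leg reads the divergence of every slice `X κ u` in the SECOND bond slot — `push₄W l r v (ν y′ ↦ dz (λ ν y′)) X μ y ν y′ =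
push₃ l r v (κ u ↦ (x z a b ↦ −Σ'_{u′} λ ν y′ u′ · Σ_{κ′} (X κ u κ′ u′ − X κ u κ′ (u′ − e_{κ′})) x z a b)) μ y` (the gauge functions bounded per coarse bond; the slices of a `LocStencil₂` table
at a positive rate are summable). -/
theorem push₄W_gauge_inner (hlam : ∀ ν y' u', |lam ν y' u'| ≤ B ν y') (hX : LocStencil₂ X C δ) (hδ : 0 < δ) (μ : Fin (d + 1)) (y : Site (d + 1))
    (ν : Fin (d + 1)) (y' : Site (d + 1)) :
    push₄W l r v (fun ν y' => dz (lam ν y')) X μ y ν y'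
      = push₃ l r v (fun κ u => fun x z a b =>
          -∑' u' : Site (d + 1), lam ν y' u' * ∑ κ' : Fin (d + 1), (X κ u κ' u' x z a b - X κ u κ' (u' - unitVec κ') x z a b)) μ y := by
  rw [push₄W_eq_push₃]
  congr 1
  funext κ u x z a b
  exact vertexW_gauge hlam (fun κ' x z a b => summable_slice_of_locStencil₂ hX hδ κ u κ' x z a b) ν y' x z a b

/-- [folklore] **OUTER TABLE SLOT**: a pure-gauge OUTER table leg reads the divergence of the inner-vertex family in the FIRST bond slot — with `F κ u := vertexW w (X κ u) ν y′` (bounded inner legs,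
`LocStencil₂` table at a positive rate, so the slices `u ↦ F κ u x z a b` are summable),
`push₄W l r (μ y ↦ dz (λ μ y)) w X μ y ν y′ = ffRead (comp (comp (Lk l) (x z a b ↦ −Σ'_u λ μ y u · Σ_κ (F κ u − F κ (u − e_κ)) x z a b)) (Rk r))`. -/
theorem push₄W_gauge_outer (hlam : ∀ μ y u, |lam μ y u| ≤ B μ y) (hw : ∀ ν y' κ u, |w ν y' κ u| ≤ Cw) (hX : LocStencil₂ X C δ) (hδ : 0 < δ)
    (μ : Fin (d + 1)) (y : Site (d + 1)) (ν : Fin (d + 1)) (y' : Site (d + 1)) :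
    push₄W l r (fun μ y => dz (lam μ y)) w X μ y ν y'
      = ffRead (comp (comp (Lk l) (fun x z a b =>
          -∑' u : Site (d + 1), lam μ y u * ∑ κ : Fin (d + 1),
            (vertexW w (X κ u) ν y' x z a b - vertexW w (X κ (u - unitVec κ)) ν y' x z a b))) (Rk r)) := by
  have hCw : 0 ≤ Cw := (abs_nonneg _).trans (hw 0 0 0 0)
  rw [push₄W]
  congr 3
  funext x z a b
  exact vertexW_gauge hlam (S := fun κ u => vertexW w (X κ u) ν y') (fun κ x z a b => summable_vertexW_slice hw hCw hX hδ κ ν y' x z a b) μ y x z a b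

/-- [folklore] **LEFT KERNEL SLOT (ff entries)**: a pure-gauge LEFT kernel leg reads the divergence of the bi-vertex `V := vertexW v (κ u ↦ vertexW w (X κ u) ν y′) μ y` in its LEFT kernel
index — bounded table legs, `LocStencil₂` table at a positive rate (so `V` decays and its columns are summable), gauge functions bounded per coarse bond:
`push₄W (α x′ ↦ dz (λ α x′)) r v w X μ y ν y′ x′ z′ (inl α) (inl β) = Σ'_z Σ_{κ₂} (−Σ'_x λ α x′ x · Σ_{κ₁} (V x z (inl κ₁) (inl κ₂) − V (x − e_{κ₁}) z (inl κ₁) (inl κ₂))) · r β z′ κ₂ z`. -/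
theorem push₄W_gauge_left_ff (hlam : ∀ α x' x, |lam α x' x| ≤ B α x') (hv : ∀ μ y κ u, |v μ y κ u| ≤ Cv) (hw : ∀ ν y' κ u, |w ν y' κ u| ≤ Cw)
    (hX : LocStencil₂ X C δ) (hδ : 0 < δ) (μ : Fin (d + 1)) (y : Site (d + 1)) (ν : Fin (d + 1)) (y' : Site (d + 1)) (x' z' : Site (d + 1)) (α β : Fin (d + 1)) :
    push₄W (fun α x' => dz (lam α x')) r v w X μ y ν y' x' z' (Sum.inl α) (Sum.inl β)
      = ∑' z : Site (d + 1), ∑ κ₂ : Fin (d + 1),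
          (-∑' x : Site (d + 1), lam α x' x * ∑ κ₁ : Fin (d + 1),
            (vertexW v (fun κ u => vertexW w (X κ u) ν y') μ y x z (Sum.inl κ₁) (Sum.inl κ₂)
              - vertexW v (fun κ u => vertexW w (X κ u) ν y') μ y (x - unitVec κ₁) z (Sum.inl κ₁) (Sum.inl κ₂))) * r β z' κ₂ z := by
  have hCv : 0 ≤ Cv := (abs_nonneg _).trans (hv 0 0 0 0)
  have hF : LocStencil (fun κ u => vertexW w (X κ u) ν y') ((d + 1 : ℕ) * (Cw * (C * Zl (d + 1) δ))) δ := locStencil_inner hw hX hδ ν y'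
  have hVdec := decays_vertexW_of_locStencil hv hCv hF hδ μ y
  have hVs : ∀ z b κ, Summable fun x => vertexW v (fun κ u => vertexW w (X κ u) ν y') μ y x z (Sum.inl κ) b := by
    intro z b κ
    refine Summable.of_norm_bounded ((ExpKernelCalculus.summable_exp_shift' (half_pos hδ) z).mul_left
      ((d + 1 : ℕ) * (Cv * ((d + 1 : ℕ) * (Cw * (C * Zl (d + 1) δ))) * Zl (d + 1) (δ / 2)))) fun x => ?_
    rw [Real.norm_eq_abs]
    exact hVdec x z (Sum.inl κ) b
  rw [push₄W_eq_push₃, push₃_inl_inl]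
  refine tsum_congr fun z => Finset.sum_congr rfl fun κ₂ _ => ?_
  congr 1
  have h := comp_Lk_gauge hlam hVs x' z α (Sum.inl κ₂)
  simp only [comp] at h
  rw [← h]
  refine tsum_congr fun x => ?_
  rw [Fintype.sum_sum_type]
  simp only [Lk_inl_inl, Lk_inl_inr, zero_mul, Finset.sum_const_zero, add_zero]

/-- [folklore] **RIGHT KERNEL SLOT (ff entries)**: a pure-gauge RIGHT kernel leg reads the divergence of `W := comp (Lk l) V` (`V` the bi-vertex) in its RIGHT kernel index —
under the summability of the right field rows of `W` (`hWs`; from leg envelopes by `summable_comp_Lk_vertexW_of_legDecay` below) and gauge functions bounded per coarse bond: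
`push₄W l (β z′ ↦ dz (λ β z′)) v w X μ y ν y′ x′ z′ (inl α) (inl β) = −Σ'_z λ β z′ z · Σ_κ (W x′ z (inl α) (inl κ) − W x′ (z − e_κ) (inl α) (inl κ))`. -/
theorem push₄W_gauge_right_ff (hlam : ∀ β z' z, |lam β z' z| ≤ B β z') {μ : Fin (d + 1)} {y : Site (d + 1)} {ν : Fin (d + 1)} {y' : Site (d + 1)}
    (hWs : ∀ x a κ, Summable fun z => comp (Lk l) (vertexW v (fun κ u => vertexW w (X κ u) ν y') μ y) x z a (Sum.inl κ))
    (x' z' : Site (d + 1)) (α β : Fin (d + 1)) :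
    push₄W l (fun β z' => dz (lam β z')) v w X μ y ν y' x' z' (Sum.inl α) (Sum.inl β)
      = -∑' z : Site (d + 1), lam β z' z * ∑ κ : Fin (d + 1),
          (comp (Lk l) (vertexW v (fun κ u => vertexW w (X κ u) ν y') μ y) x' z (Sum.inl α) (Sum.inl κ)
            - comp (Lk l) (vertexW v (fun κ u => vertexW w (X κ u) ν y') μ y) x' (z - unitVec κ) (Sum.inl α) (Sum.inl κ)) := by
  rw [push₄W]
  show ffRead (comp (comp (Lk l) (vertexW v (fun κ u => vertexW w (X κ u) ν y') μ y)) (Rk (fun β z' => dz (lam β z')))) x' z' (Sum.inl α) (Sum.inl β) = _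
  rw [ffRead_inl_inl]
  exact comp_Rk_gauge hlam hWs x' z' (Sum.inl α) β

variable {N : ℕ} {ml mv : ℝ}

/-- [folklore] **A SUFFICIENT CONDITION FOR `hWs`** (the class of leaf-17's pushes): left legs `LegDecay l N Cl ml`, outer table legs `LegDecay v N Cv mv` with `2δ < mv` and `δ < ml`,
inner legs bounded, `LocStencil₂ X C δ` with `0 < δ` ⟹ the right field rows of `comp (Lk l) (vertexW v (κ u ↦ vertexW w (X κ u) ν y′) μ y)` are summable
(`Push4Bounds.biLoc_vertexW_keep` + `Push4LocStencil.abs_comp_Lk_le`: the composite is localised at `N•y` in its right index). -/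
theorem summable_comp_Lk_vertexW_of_legDecay (hl : Push4Bounds.LegDecay l N Cl ml) (hv : Push4Bounds.LegDecay v N Cv mv)
    (hw : ∀ ν y' κ u, |w ν y' κ u| ≤ Cw) (hX : LocStencil₂ X C δ) (hδ : 0 < δ) (hml : δ < ml) (hmv : 2 * δ < mv)
    (μ : Fin (d + 1)) (y : Site (d + 1)) (ν : Fin (d + 1)) (y' : Site (d + 1)) (x : Site (d + 1)) (a : Fib d) (κ : Fin (d + 1)) :
    Summable fun z => comp (Lk l) (vertexW v (fun κ u => vertexW w (X κ u) ν y') μ y) x z a (Sum.inl κ) := by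
  have hF : LocStencil (fun κ u => vertexW w (X κ u) ν y') ((d + 1 : ℕ) * (Cw * (C * Zl (d + 1) δ))) δ := locStencil_inner hw hX hδ ν y'
  have hV := Push4Bounds.biLoc_vertexW_keep hv hF hδ.le hmv μ y
  refine Summable.of_norm_bounded ((ExpKernelCalculus.summable_exp_shift' hδ ((N : ℤ) • y)).mul_left
    ((d + 1 : ℕ) * (Cl * ((d + 1 : ℕ) * (Cv * ((d + 1 : ℕ) * (Cw * (C * Zl (d + 1) δ))) * Zl (d + 1) (mv - 2 * δ))) * Zl (d + 1) (ml - δ)) *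
      Real.exp (-δ * l1 ((N : ℤ) • x - (N : ℤ) • y)))) fun z => ?_
  rw [Real.norm_eq_abs]
  refine (Push4LocStencil.abs_comp_Lk_le hl hV hδ.le hml x z a (Sum.inl κ)).trans (le_of_eq ?_)
  rw [mul_add, Real.exp_add]
  ring

end Push

end Summit.QuantumFields.BalabanUV.Beta.GAN24.Push4GaugeSlotCells

end
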